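import Literature.MathematicalPhysics.QuantumFieldTheory.BalabanImbrieJaffe1984to88.BIJ88Scaling313Result
import Literature.MathematicalPhysics.QuantumFieldTheory.BalabanImbrieJaffe1984to88.BIJ88HoleProduct5154
import Literature.MathematicalPhysics.QuantumFieldTheory.BalabanImbrieJaffe1984to88.BIJ88RT51NoChange

/-!
# `BalabanImbrieJaffe1984to88.BIJ88Form41Succ` — T. Bałaban, J. Imbrie, A. Jaffe, *Effective action and cluster properties of the abelian
Higgs model*, Commun. Math. Phys. **114** (1988) 257–315 [BalabanImbrieJaffe1988], pp. 312–314 [PDF 56–58]: *"In this section we recover the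
induction hypothesis for k+1 instead of k"* (p. 312), *"We now scale this density from T_L^{(k+1)} to T₁^{(k+1)}, putting ψ^L(y) =
L^{−(d−2)/2}ψ¹(L⁻¹y). If we define ρ(v, ψ¹) = exp[−((d−2)/2)(log L)|T₁^{(k+1)}|] ρ^L(v, L^{−(d−2)/2}ψ¹), then the integral of ρ(v, ψ¹) is equal
to the integral of ρ^L(v, ψ^L). Thus we define the (k+1)th normalizing energy to be ℰ_{k+1} = ℰ_k + E^{(k)} + ((d−2)/2)(log L)|T₁^{(k+1)}|.
(5.15.3) Let us describe how the scaling affects a few of the objects that will be needed in the next step. Defining f^{(k+1)}(p) =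
(ie_{k+1})⁻¹ log v(p), we have … The quadratic forms become ½⟨Λ₅^{(k)′**}f^{(k+1)}, σ_{k+1,loc}Λ₅^{(k)′**}f^{(k+1)}⟩ + ½⟨Λ₈^{(k)′}ψ,
Δ_{k+1,loc}(u_{k+1})Λ₈^{(k)′}ψ⟩. The interaction and observables are scaled and written as 𝒫_{k+1,loc}(Λ₈^{(k)}) and F_{k+1,loc}(X_{σ′}),
respectively. … We exhibit the factorization of most of the terms in ρ_{k+1}(v, ψ) by writing ρ_{k+1}(v, ψ) = Σ_{{X_{ω′}}} ∫Π_{j=0}^{k}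
du^{(j)}|_{Λ^{(j)c*}_{10}} ρ′_{k+1}(v, ψ, {X_{ω′}}, {u^{(j)}}), ρ′_{k+1}(…) = χ_{k+1,Λ^{(k)′}_0} Π_{ω′}g_{k+1}(X_{ω′}) Π_{σ′}F_{k+1,loc}(X_{σ′})
Π_{j=0}^{k}[Z^{(j)}_{Λ^{(j)c*c}_{10}}Z^{(j)}_{Λ^{(j)}_{10}}(u_{k+1})] × exp[−½⟨Λ₅^{(k)′**}f^{(k+1)}, σ_{k+1,loc}Λ₅^{(k)′**}f^{(k+1)}⟩ − ½⟨Λ₈^{(k)′}ψ,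
Δ_{k+1,loc}(u_{k+1})Λ₈^{(k)′}ψ⟩ − 𝒫_{k+1,loc}(Λ₈^{(k)}) − ℰ_{k+1}], which is in the form of our original induction hypothesis, (4.1)"* (pp. 313–314) —
**THE RESULT IN THE VOCABULARY OF THE INDUCTION HYPOTHESIS (4.1) ITSELF: r18's `Term41` / `rhoPrime` / `rho` / `Represents41`
(`BIJ88InductiveForm41`) AT LEVEL `k+1`, UNDER THE SCALING (5.15.3), AND THE PACKAGING OF THE HOLE-PRODUCT FORM OF THE RESULT INTO THEM.**

statement-level skeleton of published theorems with citation tags; proofs where landed; nothing here is a claim about the Yang–Mills mass gap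

WHAT THE TREE HAD.  r18's (4.1) p. 273 is TYPED as functions: one term `T : Term41 P k` carries the factors of `ρ′_k` as data, `rhoPrime T` is the
display symbol by symbol, `rho terms T u φ = Σ_t ∫_{Π_{j<k}𝒟u^{(j)}} ρ′_k` the density, and `Represents41 terms T S F` the sentence *"integrating
over u, φ gives [F]"* (p. 274).  The §5 passage is proved at MEASURE level on p34's tested displays (`IsDT` (5.9.6) → `IsR41T`/`IsResult313`,
`BIJ88FinalForm313`), as a FUNCTION identity a.e. (`BIJ88Eq596FibreIntegral.result41_ae_eq`), and with the hole functionals as a product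
(`BIJ88HoleProduct5154.ae_eq_hole_product`: `ρ̃(v, ψ) = Σ_{ω} ∫_{Π_{j≤k}𝒟u^{(j)}} G_ω·Π_{ω′}(∫dφ^{(k)}|_{ext∩X_{ω′}} y_{ω,ω′})` a.e., over r18's
`prevMeasure P (k+1)`); the scaling (5.15.3) is r16/p34's `BIJ88RTIterated.scaleStep c ρ (v, ψ¹) = c^{2|T₁|} ρ(v, cψ¹)` (honest Jacobian; the printed
`(d−2)/2` in (5.15.3) is the located slip HOME/GAPS.md G-C2-10), applied to the tested display and to the slot table by this seat's gen 13
(`BIJ88Scaling313Result`: `scaledTable`, `gaugeForm_rescale`, `scalarForm_rescale`).  What was NOT in the tree (owner r16's NOT-done list of row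
C2.Claim@313, v2.122): the RESULT as r18's FUNCTION `rho` at level `k+1` with `Term41` data, and `Represents41` at `k+1` — *"the form of our original
induction hypothesis"* literally.

WHAT IS PROVED HERE (two small definitions with bodies — `scaleTerm`, `renameCharge` — and theorems; 0 `sorry`; no `Prop`-valued fact; standard
axioms).
* §1 **`scaleTerm c T`**: the `Term41` datum after the scaling `ψ^L = cψ¹` — the hole functionals, observables, characteristic function and
  interaction READ AT `cψ¹` (*"The interaction and observables are scaled and written as 𝒫_{k+1,loc}(Λ₈^{(k)}) and F_{k+1,loc}(X_{σ′})"*), the scalar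
  kernel RESCALED `Δ ↦ c²Δ` (*"The quadratic forms become … ½⟨Λ₈^{(k)′}ψ, Δ_{k+1,loc}(u_{k+1})Λ₈^{(k)′}ψ⟩"*, gen 13's `scalarForm_rescale` BY NAME), the
  normalizing energy SHIFTED by the Jacobian exponent, `ℰ ↦ ℰ − 2|T₁|log c` (*"Thus we define the (k+1)th normalizing energy to be …"*; for the
  printed `c = L^{−(d−2)/2}` this is `ℰ + E0prime d L |T₁|`, `scaleTerm_calE_printed`, gen 13's `jacExponent_printed` BY NAME); everything else
  (background `u_{k+1}`, `Z`-factors, charge, `Λ₅`, `σ`, `Λ₈`) untouched.  **`rhoPrime_scale`**: `ρ′[scaleTerm c T](…, φ) = c^{2|T₁|}·ρ′[T](…, cφ)`;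
  **`rho_scale`**; **`scaleStep_rho`**: `𝒮_c(ρ_k[T]) = ρ_k[scaleTerm c ∘ T]` EXACTLY (r16/p34's `scaleStep` of r18's `rho` IS r18's `rho` of the scaled
  terms — *"ρ(v, ψ¹) = exp[…]ρ^L(v, L^{−(d−2)/2}ψ¹)"* inside the (4.1) vocabulary); **`represents41_scale_iff`**: `Represents41 (scaleTerm c ∘ T) S F
  ↔ Represents41 T S F` (*"the integral of ρ(v, ψ¹) is equal to the integral of ρ^L(v, ψ^L)"* for r18's predicate; p34 gen 1's
  `integral_comp_smul_jac` BY NAME).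
* §2 **`renameCharge e′ T`** (*"Defining f^{(k+1)}(p) = (ie_{k+1})⁻¹ log v(p)"*): charge `e′`, kernel `(e′/e_k)²σ`; **`rhoPrime_renameCharge`**: the
  term density is UNCHANGED (gen 13's `gaugeForm_rescale` BY NAME), hence `rho_renameCharge`, `represents41_renameCharge_iff` — the renamed kernel
  is the one (2.12) names `σ_{k+1,loc}`, and the renaming is bookkeeping inside (4.1).
* §3 PACKAGING.  `integral_integral_congr_ae` (a `dv dψ`-a.e. identity of densities gives equal iterated integrals, no integrability needed),
  **`ae_eq_rho_of_hole_product`**: p34's hole-product conclusion (the literal output type of `BIJ88HoleProduct5154.ae_eq_hole_product` /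
  `result41_hole_product`) + a termwise TRANSCRIPTION `hT` of its integrand `G_ω·Π_{ω′}g_{ω,ω′}` into `rhoPrime (T′ ω)` ⟹ `ρ =ᵐ (v, ψ) ↦
  rho holes T′ (cfg v) ψ` — the RESULT IS r18's FUNCTION `rho` at level `k+1`; **`represents41_of_ae_eq`** (+ the `[F]`-chain `∫dvdψ ρ = [F]` ⟹
  `Represents41 holes T′ S F`); **`represents41_succ`**: FROM `Represents41 terms T S F` AT LEVEL `k` (the induction hypothesis), (5.1.1) for the
  (4.1) terms (p34 gen 5's `IsRT511`, `BIJ88RT51NoChange.bracket_eq_integral_of_isRT511` BY NAME), the chain `∫dvdψ ρ^L_{k+1} = ∫dvdψ ρ̃^L_{k+1}`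
  (gen 9's `BIJ88Eq596Density.eq596_frame_rdt`, second member) and the a.e. `rho`-form of `ρ^L_{k+1}` TO `Represents41 holes T′ S F` AT LEVEL `k+1` —
  and **`represents41_succ_scaled`**: the same for `ρ_{k+1} = 𝒮_cρ^L_{k+1}` with the terms `scaleTerm c ∘ T′` (every `c > 0`; gen 13's
  `scaleStep_congr_ae` BY NAME), i.e. *"we recover the induction hypothesis for k+1 instead of k"* as ONE implication between r18's predicates,
  modulo the displayed pointwise identities of Sects. 5.4–5.15 that produce the hole-product form (their rows) and the transcription `hT`.
* §4 A TYPING WITNESS (for the owners r18 / r16; nothing in print fails).  r18's `Term41.g : Ω → … → ℝ` types the hole functionals as REAL.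
  Consequently (`rhoPrime_im_eq_zero`, `rho_im_eq_zero`) a (4.1) density none of whose terms carries an exterior observable slot (`T.Obs` empty)
  is REAL-valued, and (`not_represents41_of_im_ne_zero`) cannot represent an expectation `[F]` with `Im [F] ≠ 0`.  But (5.15.2)/(5.15.4) pp. 313–314
  put every observable whose support is not inside the clean region `Λ^{(k)}_{13}` INTO the hole functional: *"Π_{c: X_c ⊄ ∪X_{r′}}F^L_{k+1,loc}(X_c)
  = Π_{c′}F^L_{k+1,loc}(X_{c′}) Π_{σ′}F^L_{k+1,loc}(X_{σ′}), (5.15.2) where {σ′} = {c : X_c ⊂ Λ^{(k)}_{13}}, and {c′} are the rest"*, and `g_{k+1}(X_{ω′})`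
  of (5.15.4) contains the factor `Π_{c′: X_{c′} ⊂ X_{ω′}} F_{k+1,loc}(X_{c′})` (and `Π_{σ∉σ̃, X_σ⊂X_{ω′}}F′_{k,loc}(X_σ)`) — complex-valued for a complex
  observable.  So the transcription `hT` of §3 is satisfiable as typed only when the hole functionals are real (e.g. no observable at all,
  `F = 1`: the effective action / partition function, the case of [B11]–[B13]); for a general observable the packaging needs `g` complex-valued.
  Recorded as HOME/GAPS.md entry G-C2-26 (kind: typing of the object of record vs. print; owner r18's ruling; the append-only remedy would be a
  complex-`g` twin of `Term41` with `rhoPrime` as its real case).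

HONEST SCOPE.  (i) The hole-product form itself and the transcription `hT` are INPUTS (p34's `ae_eq_hole_product` hypotheses `hprod`/`hD`/…, the
§§5.4–5.15 pointwise identities on their rows, and the identification of p34's slots with `Term41` data — gen 13's §6 did the two quadratic
forms); this file does not construct `σ_{k+1,loc}`, `Δ_{k+1,loc}(u_{k+1})`, `𝒫_{k+1,loc}`, `g_{k+1}` natively (rows C2.Eq2.14/2.34/5.15.4): the
rescaled objects ARE `Term41` data at `k+1` (this file), that they coincide with the natively defined ones is the (2.12) convention.  (ii) No
bound (p. 314: deferred in print to a subsequent paper, row C2.Txt@314); no *"compatibility"* combinatorics (the `Π_{ω′}` factorization beyond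
`hprod`); (4.3) at `k+1` is row C2.Claim@286 (this seat's gen 9).  (iii) Nothing of B1–B16; NOT summit progress; NOT continuum; NOT Clay.
CITATION HEADER (lean-in-tree rule).  Part of the lit-balaban TYPED SKELETON (HOME `run/shared/lean/pub/lit-balaban/`), PHASE-2 proof seat p31
gen 14 (unit `lit-balaban-p31-g14`; TAKING line HOME/STATUS.md 2026-08-22T08:32:15Z, free-target protocol G.5-34(d), own lane = the p. 313
scaling / RESULT line, continuation of gen 13's `BIJ88Scaling313Result`; p34 gen 11's HANDOFF item (d), unclaimed).  Rows served: **`C2.Claim@313`**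
member (owner r16, `HOME/lit-balaban-r16/ROWS-C2-part2.md`: NOT-done item *"`Term41` packaging at k+1 / the v-disintegration to r18's FUNCTION
`rho`"*), **`C2.Eq5.15.3`** member (the scaling on r18's `rho`/`Represents41`), **`C2.Eq4.1`** member (owner r18, `HOME/lit-balaban-r18/ROWS-C2.md`:
`Represents41` at `k+1`; the typing witness §4).  PDF held: `paper:balaban1988-cmp114-bij-abelian-higgs-effective-action` (journal page = PDF
page + 256); pp. 313–314 [PDF 57–58] re-read this session as images (`HOME/lit-balaban-r16/renders/cmp114/original-p057-x2.png`,
`original-p058-x2.png`; (5.15.2)/(5.15.4) quoted from them), p. 273–274 for (4.1).  Imports gen 13's `BIJ88Scaling313Result`, p34's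
`BIJ88HoleProduct5154` and p34 gen 5's `BIJ88RT51NoChange` (Literature + Mathlib only); sub-namespace `…BIJ88Form41Succ`; nothing re-declared,
nothing restated.
-/

namespace Literature.MathematicalPhysics.QuantumFieldTheory.BalabanImbrieJaffe1984to88.BIJ88Form41Succ

open Literature.MathematicalPhysics.QuantumFieldTheory.Balaban1983to89
open BIJ88Sect3Statements (U1 cfg bracket E0prime)
open BIJ85Sect1Model (HiggsField)
open BIJ88InductiveForm41 (Term41 Prev prevMeasure rhoPrime rho Represents41 gaugeForm scalarForm)
open BIJ88RTIterated (scaleStep integral_integral_scaleStep)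
open BIJ88Sect3Rescaling (integral_comp_smul_jac finrank_higgsField)
open BIJ88Scaling313Result (scalarForm_rescale gaugeForm_rescale jacExponent_printed scaleStep_congr_ae)
open BIJ88RT51GeneralStep (IsRT511)
open BIJ88RT51NoChange (bracket_eq_integral_of_isRT511)
open BIJ88RenormTransf311 (gaussWeight)
open BIJ88Eq5128Split (Interior)
open scoped BigOperators
open _root_.MeasureTheory Function

noncomputable section

variable {P : Params} {j : ℕ}

/-! ## §1 The scaling (5.15.3) on the data of a (4.1) term -/

section Scale

/-- **The (4.1) term after the scaling `ψ^L = cψ¹`** (p. 313): hole functionals `g`, observables `F_{loc}`, characteristic function `χ` and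
interaction `𝒫_{loc}` READ AT `cφ` (*"The interaction and observables are scaled and written as 𝒫_{k+1,loc}(Λ₈^{(k)}) and F_{k+1,loc}(X_{σ′})"*),
the scalar kernel rescaled `Δ ↦ c²·Δ` (*"The quadratic forms become …"*), the normalizing energy shifted by the Jacobian exponent `ℰ ↦ ℰ − 2|T₁| log c`
(*"Thus we define the (k+1)th normalizing energy to be ℰ_{k+1} = …"*); background, `Z`-factors, charge, `Λ₅`, `σ`, `Λ₈` unchanged.
[cite: BalabanImbrieJaffe1988, (5.15.3) p.313] -/
def scaleTerm (c : ℝ) (T : Term41 P j) : Term41 P j :=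
  { T with
    g := fun ω prev u φ => T.g ω prev u (c • φ)
    Floc := fun σ prev u φ => T.Floc σ prev u (c • φ)
    chi := fun prev u φ => T.chi prev u (c • φ)
    Δloc := fun w x y => ((c ^ 2 : ℝ) : ℂ) * T.Δloc w x y
    Ploc := fun prev u φ => T.Ploc prev u (c • φ)
    calE := T.calE - (2 * Fintype.card (Balaban1983to89.Site P j) : ℕ) * Real.log c }

variable (c : ℝ) (T : Term41 P j) (prev : Prev P j) (u : PBond P j → ℂ) (φ : HiggsField P j)

/-- slot: the characteristic function of the scaled term is `χ` read at `cφ`. [cite: BalabanImbrieJaffe1988, (5.15.3) p.313] -/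
theorem scaleTerm_chi : (scaleTerm c T).chi prev u φ = T.chi prev u (c • φ) := rfl

/-- slot: *"The interaction … scaled and written as 𝒫_{k+1,loc}(Λ₈^{(k)})"* — the interaction of the scaled term is `𝒫` read at `cφ`.
[cite: BalabanImbrieJaffe1988, (5.15.3) p.313] -/
theorem scaleTerm_Ploc : (scaleTerm c T).Ploc prev u φ = T.Ploc prev u (c • φ) := rfl

/-- slot: *"Thus we define the (k+1)th normalizing energy"* — the energy of the scaled term is `ℰ − 2|T₁| log c` (the Jacobian exponent absorbed).
[cite: BalabanImbrieJaffe1988, (5.15.3) p.313] -/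
theorem scaleTerm_calE :
    (scaleTerm c T).calE = T.calE - (2 * Fintype.card (Balaban1983to89.Site P j) : ℕ) * Real.log c := rfl

/-- **The printed instance of the energy shift**: for `c = L^{−(d−2)/2}` the scaled term's energy is `ℰ + E0prime d L |T₁|`, `E0prime d L n =
(d−2)(log L)·n` (r18's (3.42); the HONEST increment — gen 13's `jacExponent_printed`; the printed `(d−2)/2` of (5.15.3) is the located slip G-C2-10).
[cite: BalabanImbrieJaffe1988, (5.15.3) p.313] -/
theorem scaleTerm_calE_printed {L : ℝ} (hL : 0 < L) (d : ℕ) (T : Term41 P j) :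
    (scaleTerm (L ^ (-(((d : ℝ) - 2) / 2))) T).calE = T.calE + E0prime d L (Fintype.card (Balaban1983to89.Site P j)) := by
  rw [scaleTerm_calE, ← jacExponent_printed hL d, sub_eq_add_neg]

/-- slot: the hole functionals of the scaled term, `Π_ω g` read at `cφ`. [cite: BalabanImbrieJaffe1988, (5.15.3) p.313] -/
theorem prod_g_scaleTerm : (∏ ω, (scaleTerm c T).g ω prev u φ) = ∏ ω, T.g ω prev u (c • φ) := rfl

/-- slot: *"observables are scaled and written as F_{k+1,loc}(X_{σ′})"* — `Π_σ F_{loc}` read at `cφ`. [cite: BalabanImbrieJaffe1988, (5.15.3) p.313] -/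
theorem prod_Floc_scaleTerm : (∏ σ, (scaleTerm c T).Floc σ prev u φ) = ∏ σ, T.Floc σ prev u (c • φ) := rfl

/-- slot: *"The scaled form of the normalization factors is given in (4.6), (4.9)"* — the `Z`-factors and the background are untouched by the scaling of
the scalar field. [cite: BalabanImbrieJaffe1988, (5.15.3) p.313] -/
theorem prod_Z_scaleTerm :
    (∏ i, (scaleTerm c T).Zv i * (scaleTerm c T).Zs i ((scaleTerm c T).uk prev u)) = ∏ i, T.Zv i * T.Zs i (T.uk prev u) := rfl

/-- slot: the gauge-field quadratic form does not see the scalar field — unchanged. [cite: BalabanImbrieJaffe1988, (5.15.3) p.313] -/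
theorem gaugeForm_scaleTerm : gaugeForm (scaleTerm c T) u = gaugeForm T u := rfl

/-- **«The quadratic forms become … ½⟨Λ₈^{(k)′}ψ, Δ_{k+1,loc}(u_{k+1})Λ₈^{(k)′}ψ⟩» IN THE (4.1) VOCABULARY**: the scalar form of the scaled term (kernel
`c²Δ`) at `φ` is the scalar form of the original term at `cφ` (gen 13's `scalarForm_rescale` BY NAME). [cite: BalabanImbrieJaffe1988, (5.15.3) p.313] -/
theorem scalarForm_scaleTerm (w : PBond P 0 → ℂ) : scalarForm (scaleTerm c T) w φ = scalarForm T w (c • φ) := by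
  rw [scalarForm_rescale]
  rfl

/-- kernel: the Jacobian as an exponential, `c^{2n} = exp(2n·log c)` (`c > 0`). [cite: BalabanImbrieJaffe1988, (5.15.3) p.313] -/
theorem jac_pow_eq_exp {c : ℝ} (hc : 0 < c) (n : ℕ) : c ^ (2 * n) = Real.exp ((2 * n : ℕ) * Real.log c) := by
  rw [Real.exp_nat_mul, Real.exp_log hc]

/-- **`ρ′[scaleTerm c T](…, φ) = c^{2|T₁|}·ρ′[T](…, cφ)`** — r18's term density (4.1) of the scaled term IS the Jacobian times the term density
read at the scaled field: *"ρ(v, ψ¹) = exp[−…(log L)|T₁^{(k+1)}|] ρ^L(v, L^{−(d−2)/2}ψ¹)"* term by term, the exponent merged into `ℰ_{k+1}` (`c > 0`).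
[cite: BalabanImbrieJaffe1988, (5.15.3) p.313] -/
theorem rhoPrime_scale {c : ℝ} (hc : 0 < c) (T : Term41 P j) (prev : Prev P j) (u : PBond P j → ℂ) (φ : HiggsField P j) :
    rhoPrime (scaleTerm c T) prev u φ =
      ((c ^ (2 * Fintype.card (Balaban1983to89.Site P j)) : ℝ) : ℂ) * rhoPrime T prev u (c • φ) := by
  have hE : Real.exp (-(1 / 2 : ℝ) * gaugeForm T u - (1 / 2 : ℝ) * scalarForm T (T.uk prev u) (c • φ) - T.Ploc prev u (c • φ)
        - (T.calE - (2 * Fintype.card (Balaban1983to89.Site P j) : ℕ) * Real.log c)) =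
      c ^ (2 * Fintype.card (Balaban1983to89.Site P j)) *
        Real.exp (-(1 / 2 : ℝ) * gaugeForm T u - (1 / 2 : ℝ) * scalarForm T (T.uk prev u) (c • φ) - T.Ploc prev u (c • φ) - T.calE) := by
    rw [jac_pow_eq_exp hc, ← Real.exp_add]
    congr 1
    ring
  simp only [rhoPrime]
  rw [prod_g_scaleTerm, prod_Floc_scaleTerm, prod_Z_scaleTerm, gaugeForm_scaleTerm, scalarForm_scaleTerm, scaleTerm_chi,
    scaleTerm_Ploc, scaleTerm_calE]
  -- the background of the scaled term is the old background
  have huk : (scaleTerm c T).uk prev u = T.uk prev u := rfl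
  rw [huk, hE]
  push_cast
  ring

/-- **`ρ_k[scaleTerm c ∘ T](u, φ) = c^{2|T₁|}·ρ_k[T](u, cφ)`** for r18's density `rho` (the Jacobian leaves the fluctuation integrals and the sum
over terms). [cite: BalabanImbrieJaffe1988, (5.15.3) p.313] -/
theorem rho_scale {ι : Type*} (terms : Finset ι) (T : ι → Term41 P j) {c : ℝ} (hc : 0 < c) (u : PBond P j → ℂ) (φ : HiggsField P j) :
    rho terms (fun t => scaleTerm c (T t)) u φ =
      ((c ^ (2 * Fintype.card (Balaban1983to89.Site P j)) : ℝ) : ℂ) * rho terms T u (c • φ) := by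
  simp only [rho, rhoPrime_scale hc, integral_const_mul, Finset.mul_sum]

/-- **THE SCALING (5.15.3) OF A (4.1) DENSITY IS A (4.1) DENSITY**: r16/p34's `𝒮_c = scaleStep c` (honest Jacobian `c^{dim_ℝ ℂ^{T₁}}`) applied to
`(v, ψ) ↦ ρ_k[T](w(v), ψ)` is EXACTLY `(v, ψ¹) ↦ ρ_k[scaleTerm c ∘ T](w(v), ψ¹)` — *"ρ(v, ψ¹) = exp[…] ρ^L(v, L^{−(d−2)/2}ψ¹)"* never leaves the
vocabulary of (4.1) (`w` = any reading of the group-valued field as a `ℂ`-valued bond field, e.g. `cfg`; `c > 0`).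
[cite: BalabanImbrieJaffe1988, (5.15.3) p.313] -/
theorem scaleStep_rho {ι : Type*} (terms : Finset ι) (T : ι → Term41 P j) {c : ℝ} (hc : 0 < c)
    (w : GaugeField P j U1 → (PBond P j → ℂ)) :
    scaleStep c (fun v ψ => rho terms T (w v) ψ) = fun v ψ => rho terms (fun t => scaleTerm c (T t)) (w v) ψ := by
  funext v ψ
  simp only [scaleStep]
  rw [rho_scale terms T hc, finrank_higgsField]

/-- **«then the integral of ρ(v, ψ¹) is equal to the integral of ρ^L(v, ψ^L)» FOR r18's PREDICATE**: the scaled terms represent `[F]` iff the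
original terms do — `Represents41 (scaleTerm c ∘ T) S F ↔ Represents41 T S F` (`c > 0`; the substitution `φ = cφ′` in the `𝒟φ`-integral, p34 gen 1's
`integral_comp_smul_jac`). [cite: BalabanImbrieJaffe1988, (5.15.3) p.313] -/
theorem represents41_scale_iff {ι : Type*} (terms : Finset ι) (T : ι → Term41 P j) {c : ℝ} (hc : 0 < c)
    (S : GaugeField P 0 U1 → (Balaban1983to89.Site P 0 → ℂ) → ℝ) (F : GaugeField P 0 U1 → (Balaban1983to89.Site P 0 → ℂ) → ℂ) :
    Represents41 terms (fun t => scaleTerm c (T t)) S F ↔ Represents41 terms T S F := by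
  have h : ∀ U : GaugeField P j U1,
      ∫ φ : HiggsField P j, rho terms (fun t => scaleTerm c (T t)) (cfg U) φ = ∫ φ : HiggsField P j, rho terms T (cfg U) φ := by
    intro U
    rw [integral_comp_smul_jac (fun φ => rho terms T (cfg U) φ) hc]
    refine integral_congr_ae (ae_of_all _ fun φ => ?_)
    simp only [rho_scale terms T hc, finrank_higgsField, Complex.real_smul]
  unfold Represents41
  simp_rw [h]

end Scale

/-! ## §2 *"Defining f^{(k+1)}(p) = (ie_{k+1})⁻¹ log v(p)"*: the charge renaming inside (4.1) -/

section Charge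

/-- **The (4.1) term with the field strength written at a new charge**: charge `e′`, kernel `(e′/e_k)²·σ` (*"Defining f^{(k+1)}(p) = (ie_{k+1})⁻¹
log v(p) … The quadratic forms become ½⟨Λ₅^{(k)′**}f^{(k+1)}, σ_{k+1,loc}Λ₅^{(k)′**}f^{(k+1)}⟩ …"*: the renamed kernel is the one (2.12) names `σ_{k+1,loc}`).
[cite: BalabanImbrieJaffe1988, (5.15.3) p.313] -/
def renameCharge (e' : ℝ) (T : Term41 P j) : Term41 P j :=
  { T with ek := e', σloc := fun p p' => (e' / T.ek) ^ 2 * T.σloc p p' }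

/-- **The charge renaming does not change the term density** (`e_k, e′ ≠ 0`; gen 13's `gaugeForm_rescale` BY NAME: `e_kf = e′f′` makes `⟨f, σf⟩ =
⟨f′, (e′/e_k)²σ f′⟩`). [cite: BalabanImbrieJaffe1988, (5.15.3) p.313] -/
theorem rhoPrime_renameCharge (T : Term41 P j) {e' : ℝ} (hek : T.ek ≠ 0) (he' : e' ≠ 0) (prev : Prev P j) (u : PBond P j → ℂ)
    (φ : HiggsField P j) : rhoPrime (renameCharge e' T) prev u φ = rhoPrime T prev u φ := by
  have hg : gaugeForm (renameCharge e' T) u = gaugeForm T u := (gaugeForm_rescale T hek he' u).symm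
  simp only [rhoPrime]
  rw [hg]
  rfl

/-- Hence r18's density `rho` is unchanged by the charge renaming of every term. [cite: BalabanImbrieJaffe1988, (5.15.3) p.313] -/
theorem rho_renameCharge {ι : Type*} (terms : Finset ι) (T : ι → Term41 P j) (e' : ι → ℝ) (hek : ∀ t ∈ terms, (T t).ek ≠ 0)
    (he' : ∀ t ∈ terms, e' t ≠ 0) (u : PBond P j → ℂ) (φ : HiggsField P j) :
    rho terms (fun t => renameCharge (e' t) (T t)) u φ = rho terms T u φ := by
  simp only [rho]
  refine Finset.sum_congr rfl fun t ht => ?_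
  simp_rw [rhoPrime_renameCharge (T t) (hek t ht) (he' t ht)]

/-- … and so is the representation property `Represents41`. [cite: BalabanImbrieJaffe1988, (5.15.3) p.313] -/
theorem represents41_renameCharge_iff {ι : Type*} (terms : Finset ι) (T : ι → Term41 P j) (e' : ι → ℝ)
    (hek : ∀ t ∈ terms, (T t).ek ≠ 0) (he' : ∀ t ∈ terms, e' t ≠ 0)
    (S : GaugeField P 0 U1 → (Balaban1983to89.Site P 0 → ℂ) → ℝ) (F : GaugeField P 0 U1 → (Balaban1983to89.Site P 0 → ℂ) → ℂ) :
    Represents41 terms (fun t => renameCharge (e' t) (T t)) S F ↔ Represents41 terms T S F := by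
  unfold Represents41
  simp_rw [rho_renameCharge terms T e' hek he']

end Charge

/-! ## §3 Packaging the RESULT into `rho` / `Represents41` at level `k+1` -/

section Packaging

variable {k : ℕ}

/-- kernel: a `dv dψ`-a.e. identity of two densities gives equal iterated integrals `∫dv∫dψ` (Fubini for null sets; no integrability needed —
a non-integrable section integrates to `0` on both sides alike). [cite: BalabanImbrieJaffe1988, (4.1) p.274] -/
theorem integral_integral_congr_ae {f g : GaugeField P (k+1) U1 → HiggsField P (k+1) → ℂ}
    (h : uncurry f =ᵐ[(fieldMeasure P (k+1) U1).prod volume] uncurry g) :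
    ∫ v, ∫ ψ, f v ψ ∂volume ∂fieldMeasure P (k+1) U1 = ∫ v, ∫ ψ, g v ψ ∂volume ∂fieldMeasure P (k+1) U1 := by
  refine integral_congr_ae ?_
  filter_upwards [Measure.ae_ae_of_ae_prod h] with v hv
  exact integral_congr_ae hv

/-- kernel: two term-indexed fluctuation integrands that agree termwise give the same `Σ_ω ∫_{Π𝒟u^{(j)}}`. [cite: BalabanImbrieJaffe1988, (4.1) p.273] -/
theorem sum_integral_congr {Ω : Type*} (holes : Finset Ω) {Φ Φ' : Ω → Prev P (k+1) → ℂ}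
    (h : ∀ ω ∈ holes, ∀ pp, Φ ω pp = Φ' ω pp) :
    ∑ ω ∈ holes, ∫ pp, Φ ω pp ∂prevMeasure P (k+1) = ∑ ω ∈ holes, ∫ pp, Φ' ω pp ∂prevMeasure P (k+1) :=
  Finset.sum_congr rfl fun ω hω => integral_congr_ae (ae_of_all _ fun pp => h ω hω pp)

/-- **THE RESULT IS r18's FUNCTION `rho` AT LEVEL `k+1`** (packaging).  INPUT: the hole-product form of the density — the literal conclusion of p34's
`BIJ88HoleProduct5154.ae_eq_hole_product` / `result41_hole_product`: `ρ(v, ψ) = Σ_{ω∈holes} ∫_{Π_{j≤k}𝒟u^{(j)}} G_ω({u^{(j)}}; v, ψ)·Π_{ω′}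
(∫dφ^{(k)}|_{ext∩X_{ω′}} y_{ω,ω′})` for `dv dψ`-a.e. `(v, ψ)` — and the TRANSCRIPTION `hT` of each integrand into the term density `ρ′_{k+1}` of a `Term41`
datum `T′ ω` at level `k+1` (*"ρ′_{k+1} = χ_{k+1,Λ^{(k)′}_0} Π_{ω′}g_{k+1}(X_{ω′}) Π_{σ′}F_{k+1,loc}(X_{σ′}) Π_{j=0}^{k}[Z^{(j)}Z^{(j)}(u_{k+1})] exp[…]"*,
the block field read as the unit-lattice gauge field of level `k+1` through `cfg`).  CONCLUSION: `ρ = (v, ψ) ↦ ρ_{k+1}[T′](cfg v, ψ)` a.e. —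
*"ρ_{k+1}(v, ψ) = Σ_{{X_{ω′}}} ∫Π_{j=0}^{k} du^{(j)} ρ′_{k+1}(v, ψ, {X_{ω′}}, {u^{(j)}})"* with r18's `rho`, `prevMeasure P (k+1)` (*"du^{(j)} is the
normalized measure"*). [cite: BalabanImbrieJaffe1988, (5.15.4) p.314] -/
theorem ae_eq_rho_of_hole_product {Ω : Type*} (holes : Finset Ω) (DΩ : Ω → Interior P k)
    (KΩ : Ω → Type*) [∀ ω, Fintype (KΩ ω)] [∀ ω, DecidableEq (KΩ ω)]
    (comp : (ω : Ω) → {x : Balaban1983to89.Site P k // x ∉ (DΩ ω).Ix} → KΩ ω)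
    (G : Ω → Prev P (k+1) → GaugeField P (k+1) U1 → HiggsField P (k+1) → ℂ)
    (y : (ω : Ω) → (κ : KΩ ω) → Prev P (k+1) → ({x // comp ω x = κ} → ℂ) → GaugeField P (k+1) U1 → HiggsField P (k+1) → ℂ)
    {ρL : GaugeField P (k+1) U1 → HiggsField P (k+1) → ℂ}
    (hR : uncurry ρL =ᵐ[(fieldMeasure P (k+1) U1).prod volume]
      uncurry (fun v ψ => ∑ ω ∈ holes, ∫ pp, (G ω pp v ψ * ∏ κ, ∫ w : {x // comp ω x = κ} → ℂ, y ω κ pp w v ψ) ∂prevMeasure P (k+1)))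
    (T' : Ω → Term41 P (k+1))
    (hT : ∀ ω ∈ holes, ∀ (pp : Prev P (k+1)) (v : GaugeField P (k+1) U1) (ψ : HiggsField P (k+1)),
      G ω pp v ψ * ∏ κ, ∫ w : {x // comp ω x = κ} → ℂ, y ω κ pp w v ψ = rhoPrime (T' ω) pp (cfg v) ψ) :
    uncurry ρL =ᵐ[(fieldMeasure P (k+1) U1).prod volume] uncurry (fun v ψ => rho holes T' (cfg v) ψ) := by
  have hfun : (fun v ψ => ∑ ω ∈ holes, ∫ pp, (G ω pp v ψ * ∏ κ, ∫ w : {x // comp ω x = κ} → ℂ, y ω κ pp w v ψ) ∂prevMeasure P (k+1)) =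
      fun v ψ => rho holes T' (cfg v) ψ := by
    funext v ψ
    simp only [rho]
    exact sum_integral_congr holes fun ω hω pp => hT ω hω pp v ψ
  rw [hfun] at hR
  exact hR

/-- **`Represents41` AT LEVEL `k+1` FROM THE PACKAGED DENSITY**: if `ρ` is a.e. r18's `(v, ψ) ↦ ρ_{k+1}[T′](cfg v, ψ)` and `∫dvdψ ρ = [F]` (the
normalization chain of (5.1.3)/(3.13): `∫dvdψ ρ_{k+1} = ∫dvdψ ρ^L_{k+1} = ∫dvdψ ρ̃^L_{k+1} = [F]`), then the terms `T′` REPRESENT `[F]` — p. 274 *"If we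
integrate this density over the u, φ variables, we obtain our original unnormalized expectation [F]"* at level `k+1`.
[cite: BalabanImbrieJaffe1988, (4.1) p.274] -/
theorem represents41_of_ae_eq {ι : Type*} (terms : Finset ι) (T' : ι → Term41 P (k+1))
    {ρL : GaugeField P (k+1) U1 → HiggsField P (k+1) → ℂ}
    (hρ : uncurry ρL =ᵐ[(fieldMeasure P (k+1) U1).prod volume] uncurry (fun v ψ => rho terms T' (cfg v) ψ))
    {S : GaugeField P 0 U1 → (Balaban1983to89.Site P 0 → ℂ) → ℝ} {F : GaugeField P 0 U1 → (Balaban1983to89.Site P 0 → ℂ) → ℂ}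
    (hF : ∫ v, ∫ ψ, ρL v ψ ∂volume ∂fieldMeasure P (k+1) U1 = bracket S F) :
    Represents41 terms T' S F := by
  unfold Represents41
  rw [← hF]
  exact (integral_integral_congr_ae hρ).symm

/-- **The scaled density packaged**: if `ρ^L_{k+1}` is a.e. the `rho`-form with terms `T′`, then `ρ_{k+1} = 𝒮_cρ^L_{k+1}` is a.e. the `rho`-form with
the scaled terms `scaleTerm c ∘ T′` (gen 13's `scaleStep_congr_ae` + `scaleStep_rho`; `c > 0`). [cite: BalabanImbrieJaffe1988, (5.15.3) p.313] -/
theorem scaleStep_ae_eq_rho {ι : Type*} (terms : Finset ι) (T' : ι → Term41 P (k+1))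
    {ρL : GaugeField P (k+1) U1 → HiggsField P (k+1) → ℂ}
    (hρ : uncurry ρL =ᵐ[(fieldMeasure P (k+1) U1).prod volume] uncurry (fun v ψ => rho terms T' (cfg v) ψ)) {c : ℝ} (hc : 0 < c) :
    uncurry (scaleStep c ρL) =ᵐ[(fieldMeasure P (k+1) U1).prod volume]
      uncurry (fun v ψ => rho terms (fun t => scaleTerm c (T' t)) (cfg v) ψ) := by
  have h := scaleStep_congr_ae hc.ne' hρ
  rw [scaleStep_rho terms T' hc cfg] at h
  exact h

/-- **«WE RECOVER THE INDUCTION HYPOTHESIS FOR k+1 INSTEAD OF k»** (p. 312) AS ONE IMPLICATION BETWEEN r18's PREDICATES (modulo the displayed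
pointwise identities of Sects. 5.4–5.15 that produce the `rho`-form, INPUT `hρ`).  FROM: the induction hypothesis `Represents41 terms T S F` at level
`k` (p. 274); the renormalization transformation (5.1.1) with (5.1.4) for the (4.1) terms (p34 gen 5's `IsRT511` over `fieldMeasure ⊗ prevMeasure`,
integrable term densities, `a > 0`, `d ≥ 2`); the chain `∫dvdψ ρ^L_{k+1} = ∫dvdψ ρ̃^L_{k+1}` of the §5 operations (gen 9's
`BIJ88Eq596Density.eq596_frame_rdt`, second member, for the renamed density, which the later operations only REWRITE); the `rho`-form of `ρ^L_{k+1}` at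
level `k+1` with terms `T′`.  TO: `Represents41 holes T′ S F` at level `k+1` (p34 gen 5's `bracket_eq_integral_of_isRT511` BY NAME).
[cite: BalabanImbrieJaffe1988, (5.15.4) p.314] -/
theorem represents41_succ {ι Ω : Type*} (hd : 2 ≤ P.d) {a : ℝ} (ha : 0 < a) {terms : Finset ι} {T : ι → Term41 P k}
    {S : GaugeField P 0 U1 → (Balaban1983to89.Site P 0 → ℂ) → ℝ} {F : GaugeField P 0 U1 → (Balaban1983to89.Site P 0 → ℂ) → ℂ}
    (h41 : Represents41 terms T S F)
    {Qu : GaugeField P k U1 → GaugeField P (k+1) U1} {Qφ : ι → Prev P k → GaugeField P k U1 → HiggsField P k → HiggsField P (k+1)}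
    {ρtilde ρL : GaugeField P (k+1) U1 → HiggsField P (k+1) → ℂ}
    (h511 : IsRT511 terms Qu Qφ a (fun t prev U φ => rhoPrime (T t) prev (cfg U) φ) ρtilde)
    (hint : ∀ t ∈ terms, Integrable
      (fun q : GaugeField P k U1 × (Prev P k × HiggsField P k) => rhoPrime (T t) q.2.1 (cfg q.1) q.2.2)
      ((fieldMeasure P k U1).prod ((prevMeasure P k).prod volume)))
    (hchain : ∫ v, ∫ ψ, ρL v ψ ∂volume ∂fieldMeasure P (k+1) U1 = ∫ v, ∫ ψ, ρtilde v ψ ∂volume ∂fieldMeasure P (k+1) U1)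
    (holes : Finset Ω) (T' : Ω → Term41 P (k+1))
    (hρ : uncurry ρL =ᵐ[(fieldMeasure P (k+1) U1).prod volume] uncurry (fun v ψ => rho holes T' (cfg v) ψ)) :
    Represents41 holes T' S F :=
  represents41_of_ae_eq holes T' hρ (hchain.trans (bracket_eq_integral_of_isRT511 hd ha h41 h511 hint).symm)

/-- **… AND AFTER THE SCALING (5.15.3)**: under the same inputs, for every `c > 0` the scaled density `ρ_{k+1} = 𝒮_cρ^L_{k+1}` is a.e. r18's `rho` of
the scaled terms `scaleTerm c ∘ T′` AND these terms represent `[F]` at level `k+1` — *"ρ_{k+1}(v, ψ) = Σ_{{X_{ω′}}} ∫Π_{j=0}^{k} du^{(j)} ρ′_{k+1} … which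
is in the form of our original induction hypothesis, (4.1)"* together with *"integrating over u, φ gives [F]"* (the printed `c` is `L^{−(d−2)/2}`; the
energy slot then carries `E0prime`, `scaleTerm_calE_printed`). [cite: BalabanImbrieJaffe1988, (5.15.4) p.314] -/
theorem represents41_succ_scaled {ι Ω : Type*} (hd : 2 ≤ P.d) {a : ℝ} (ha : 0 < a) {terms : Finset ι} {T : ι → Term41 P k}
    {S : GaugeField P 0 U1 → (Balaban1983to89.Site P 0 → ℂ) → ℝ} {F : GaugeField P 0 U1 → (Balaban1983to89.Site P 0 → ℂ) → ℂ}
    (h41 : Represents41 terms T S F)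
    {Qu : GaugeField P k U1 → GaugeField P (k+1) U1} {Qφ : ι → Prev P k → GaugeField P k U1 → HiggsField P k → HiggsField P (k+1)}
    {ρtilde ρL : GaugeField P (k+1) U1 → HiggsField P (k+1) → ℂ}
    (h511 : IsRT511 terms Qu Qφ a (fun t prev U φ => rhoPrime (T t) prev (cfg U) φ) ρtilde)
    (hint : ∀ t ∈ terms, Integrable
      (fun q : GaugeField P k U1 × (Prev P k × HiggsField P k) => rhoPrime (T t) q.2.1 (cfg q.1) q.2.2)
      ((fieldMeasure P k U1).prod ((prevMeasure P k).prod volume)))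
    (hchain : ∫ v, ∫ ψ, ρL v ψ ∂volume ∂fieldMeasure P (k+1) U1 = ∫ v, ∫ ψ, ρtilde v ψ ∂volume ∂fieldMeasure P (k+1) U1)
    (holes : Finset Ω) (T' : Ω → Term41 P (k+1))
    (hρ : uncurry ρL =ᵐ[(fieldMeasure P (k+1) U1).prod volume] uncurry (fun v ψ => rho holes T' (cfg v) ψ)) {c : ℝ} (hc : 0 < c) :
    uncurry (scaleStep c ρL) =ᵐ[(fieldMeasure P (k+1) U1).prod volume]
        uncurry (fun v ψ => rho holes (fun ω => scaleTerm c (T' ω)) (cfg v) ψ) ∧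
      Represents41 holes (fun ω => scaleTerm c (T' ω)) S F :=
  ⟨scaleStep_ae_eq_rho holes T' hρ hc,
    (represents41_scale_iff holes T' hc S F).mpr (represents41_succ hd ha h41 h511 hint hchain holes T' hρ)⟩

end Packaging

/-! ## §4 Typing witness: the hole functionals of `Term41` are real-valued -/

section Typing

/-- **A (4.1) term without exterior observable slot is REAL in r18's typing** (`Term41.g : … → ℝ`, and `χ`, `Z`, the exponential are real; only
`F_{k,loc}` is complex): `Im ρ′_k[T] = 0` when `T.Obs` is empty. [cite: BalabanImbrieJaffe1988, (4.1) p.273] -/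
theorem rhoPrime_im_eq_zero (T : Term41 P j) [IsEmpty T.Obs] (prev : Prev P j) (u : PBond P j → ℂ) (φ : HiggsField P j) :
    (rhoPrime T prev u φ).im = 0 := by
  simp only [rhoPrime, Finset.univ_eq_empty, Finset.prod_empty, mul_one, Complex.ofReal_im]

/-- kernel: hence such a term density is the coercion of its real part. [cite: BalabanImbrieJaffe1988, (4.1) p.273] -/
theorem rhoPrime_eq_ofReal_re (T : Term41 P j) [IsEmpty T.Obs] (prev : Prev P j) (u : PBond P j → ℂ) (φ : HiggsField P j) :
    rhoPrime T prev u φ = (((rhoPrime T prev u φ).re : ℝ) : ℂ) :=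
  Complex.ext (by simp) (by simp [rhoPrime_im_eq_zero])

/-- **A (4.1) density none of whose terms carries an exterior observable slot is REAL-valued** in r18's typing: `Im ρ_k[T](u, φ) = 0` (the
fluctuation integrals of real functions are real).  Print's (5.15.2)/(5.15.4) absorb every observable whose support is not inside `Λ^{(k)}_{13}` into
the hole functional `g_{k+1}(X_{ω′}) ∋ Π_{c′: X_{c′}⊂X_{ω′}}F_{k+1,loc}(X_{c′})`, which is complex for a complex observable — so after such a step the
printed `ρ_{k+1}` is in general NOT of this real type (HOME/GAPS.md G-C2-26). [cite: BalabanImbrieJaffe1988, (5.15.4) p.314] -/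
theorem rho_im_eq_zero {ι : Type*} (terms : Finset ι) (T : ι → Term41 P j) (h : ∀ t ∈ terms, IsEmpty (T t).Obs) (u : PBond P j → ℂ)
    (φ : HiggsField P j) : (rho terms T u φ).im = 0 := by
  rw [rho, Complex.im_sum]
  refine Finset.sum_eq_zero fun t ht => ?_
  haveI := h t ht
  have hfun : (fun prev => rhoPrime (T t) prev u φ) = fun prev => (((rhoPrime (T t) prev u φ).re : ℝ) : ℂ) :=
    funext fun prev => rhoPrime_eq_ofReal_re (T t) prev u φ
  rw [hfun, integral_complex_ofReal, Complex.ofReal_im]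

/-- kernel: the `𝒟φ`- and `𝒟u`-integrals of such a density are real as well. [cite: BalabanImbrieJaffe1988, (4.1) p.274] -/
theorem integral_integral_rho_im_eq_zero {ι : Type*} (terms : Finset ι) (T : ι → Term41 P j) (h : ∀ t ∈ terms, IsEmpty (T t).Obs) :
    (∫ U, (∫ φ : HiggsField P j, rho terms T (cfg U) φ) ∂(fieldMeasure P j U1)).im = 0 := by
  have inner : ∀ U : GaugeField P j U1, ∫ φ : HiggsField P j, rho terms T (cfg U) φ =
      (((∫ φ : HiggsField P j, (rho terms T (cfg U) φ).re) : ℝ) : ℂ) := by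
    intro U
    rw [← integral_complex_ofReal]
    refine integral_congr_ae (ae_of_all _ fun φ => ?_)
    exact Complex.ext (by simp) (by simp [rho_im_eq_zero terms T h])
  simp_rw [inner]
  rw [integral_complex_ofReal, Complex.ofReal_im]

/-- **THE WITNESS**: (4.1) terms in r18's typing with no exterior observable slot cannot represent an expectation with `Im [F] ≠ 0` — whereas in
print, once every observable support has been absorbed into the hole functionals by (5.15.2)/(5.15.4), `ρ_{k+1}` has no exterior observable and
still integrates to `[F]` (e.g. `F = i·F₀` with `[F₀] ≠ 0` real).  The packaging of §3 therefore needs real hole functionals as typed; print's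
`g_{k+1}` is complex in general (HOME/GAPS.md G-C2-26, owner r18's ruling on the type of `Term41.g`). [cite: BalabanImbrieJaffe1988, (5.15.4) p.314] -/
theorem not_represents41_of_im_ne_zero {ι : Type*} (terms : Finset ι) (T : ι → Term41 P j) (h : ∀ t ∈ terms, IsEmpty (T t).Obs)
    {S : GaugeField P 0 U1 → (Balaban1983to89.Site P 0 → ℂ) → ℝ} {F : GaugeField P 0 U1 → (Balaban1983to89.Site P 0 → ℂ) → ℂ}
    (hF : (bracket S F).im ≠ 0) : ¬ Represents41 terms T S F := by
  intro hrep
  apply hF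
  rw [← hrep]
  exact integral_integral_rho_im_eq_zero terms T h

end Typing

end

end Literature.MathematicalPhysics.QuantumFieldTheory.BalabanImbrieJaffe1984to88.BIJ88Form41Succ
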